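import Summits.QuantumFields.QCD.Theses.QuarksAsStableAction

/-!
# Line `least_threshold` for crux `QuarksAsStableAction.StableActionBridge` (stmt-QuantumFields-9737) — registered skeleton
# (crux-strategist unit cstrat-stmt-QuantumFields-9737-r1; EXEMPT-46 re-exam fix of the TRIVIAL-SEAM split of line `Sketch`)

THREE REGISTERED STUBS = the three statement-shaped pieces of the strategist's decomposition, each an ITEM of route
QuarksAsStableAction BY NAME (route rev 10, commit 140837cc6733), none the crux or the conjunct reworded (BC2 probes
piece → QCD / piece → StableActionBridge failed for every piece; folder bc/ of the strategist seat):

* `stub_thresholdQCD`       : `ThresholdQCD`       — item stmt-QuantumFields-8794 (threshold regime; shared with route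
  HeavyThresholdYMBridge, whose cruxes RobustYangMillsRG 14958 → ConstructiveDecouplingRG 14667 are its lines);
* `stub_massContinuation`   : `MassContinuation`   — item stmt-QuantumFields-18327 (THE MASSIVE PHASE IS OPEN BELOW A UNIFORMLY
  GAPPED THRESHOLD: uniform-in-mass UV/IR stability of light Wilson quarks + Vitali continuation in the bare mass);
* `stub_chiralTupleGapless` : `ChiralTupleGapless` — item stmt-QuantumFields-18328 (THE GAPLESSNESS INPUT: a regularisation
  realising the body on a half-orthant has a mass tuple with no lattice gap at any positive rate — the chiral tuple).

COMPOSITION `StableActionBridge_of : ThresholdQCD → MassContinuation → ChiralTupleGapless → StableActionBridge` is a REAL PROOF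
(no sorry; axioms propext, Classical.choice, Quot.sound): the least admissible threshold `M⋆ = sInf {M | body above M}` exists
(bounded below by the gapless tuple — a threshold below its least component would gap it), is admissible (least-component
argument over `Fin N_f`, `exists_lt_of_csInf_lt`), the lattice gap CLOSES above it (else mass continuation yields the threshold
`M⋆ − δ`, contradicting `csInf_le`), and re-centring `m_crit(k) ↦ m_crit(k) + a_k M⋆/Z_m(k)` (`mcritShift`: changes neither
`HasMassScaling` nor the scheme at shifted masses) yields the re-typed `QCDOf N_f` INCLUDING `IsChiralAtZero` (`qcdOf_of_leastThreshold`,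
no sign condition on `M⋆`) — the additive mass renormalisation is PINNED by an extremal argument, not postulated.  `N_f = 2, 3`
give `QCD`, hence the bridge (its hypotheses A = 9735, S = 9736 are theorems of the tree and unused).  This replaces the
modus-ponens seam `ThresholdQCD → (ThresholdQCD → QCDOf) → QCD` of line `Sketch` (AUDIT-c13 / EXEMPT-46: TRIVIAL-SEAM).

Also: `stableActionBridgeOfPieces_proof : StableActionBridgeOfPieces` — the glue item stmt-QuantumFields-18329 BY NAME (a prover
lands this file's lemmas + that theorem under Theorems/ with `--workitem stmt-QuantumFields-18329`; planner seats cannot write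
Theorems/), and `chiralCompletion_of_pieces : MassContinuation → ChiralTupleGapless → ChiralCompletion` (item 17394 is DERIVED,
re-badged support at rev 9).

`lean check`: rc 0, sorries ONLY in the three `stub_*`.
-/

noncomputable section

namespace Summit.QuantumFields.QCD.Cruxes.StableActionBridge.LeastThreshold

open Filter Literature.MathematicalPhysics.QuantumFieldTheory
open Summit.QuantumFields.QCD.Theses.QuarksAsStableAction (StableActionBridge ThresholdQCD ChiralCompletion
  MassContinuation ChiralTupleGapless StableActionBridgeOfPieces)

/-! ## Registered stubs (route items by name) -/

/-- **stub 1 — threshold regime** = item stmt-QuantumFields-8794 `ThresholdQCD`. -/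
theorem stub_thresholdQCD : ThresholdQCD := by
  sorry

/-- **stub 2 — mass continuation** = item stmt-QuantumFields-18327 `MassContinuation`. -/
theorem stub_massContinuation : MassContinuation := by
  sorry

/-- **stub 3 — the chiral tuple is gapless** = item stmt-QuantumFields-18328 `ChiralTupleGapless`. -/
theorem stub_chiralTupleGapless : ChiralTupleGapless := by
  sorry

variable {Nf : ℕ}

/-! ## The abstract extremal argument: the least admissible threshold -/

/-- **Least-threshold lemma** (order theory on `ℝ`, `N_f ≠ 0`).  `P m` = "the tuple `m` is good", `G m ε` = "rate-`ε`
gap at `m`".  If good tuples are gapped at some positive rate, some threshold is admissible (`P` above it),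
admissibility is open below every uniformly gapped admissible threshold, and some tuple is gapless at every rate, then
the INFIMUM of the admissible thresholds is admissible and the gap closes above it. [folklore] -/
theorem exists_least_threshold [NeZero Nf] (P : (Fin Nf → ℝ) → Prop) (G : (Fin Nf → ℝ) → ℝ → Prop)
    (hPG : ∀ m, P m → ∃ Δ > 0, G m Δ)
    (hT : ∃ M₀ : ℝ, ∀ m, (∀ f, M₀ < m f) → P m)
    (hO : ∀ M ε : ℝ, 0 < ε → (∀ m, (∀ f, M < m f) → P m) → (∀ m, (∀ f, M < m f) → G m ε) →
      ∃ δ > 0, ∀ m, (∀ f, M - δ < m f) → P m)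
    (hG : ∃ m₀, ∀ Δ, 0 < Δ → ¬ G m₀ Δ) :
    ∃ M : ℝ, (∀ m, (∀ f, M < m f) → P m) ∧ ∀ ε > 0, ∃ m, (∀ f, M < m f) ∧ ¬ G m ε := by
  classical
  -- the set of admissible thresholds: an up-set of `ℝ`
  set S : Set ℝ := {M | ∀ m : Fin Nf → ℝ, (∀ f, M < m f) → P m} with hS
  obtain ⟨M₀, hM₀⟩ := hT
  have hne : S.Nonempty := ⟨M₀, hM₀⟩
  -- the gapless tuple bounds the admissible thresholds from below by its least component
  obtain ⟨m₀, hm₀⟩ := hG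
  have hbdd : BddBelow S := by
    refine ⟨Finset.univ.inf' Finset.univ_nonempty m₀, fun M hM => ?_⟩
    by_contra hlt
    push Not at hlt
    have hall : ∀ f, M < m₀ f := fun f =>
      lt_of_lt_of_le hlt (Finset.inf'_le _ (Finset.mem_univ f))
    obtain ⟨Δ, hΔ, hgap⟩ := hPG m₀ (hM m₀ hall)
    exact hm₀ Δ hΔ hgap
  -- (1) the infimum is admissible: a tuple above it has its least component above some admissible threshold
  have hinf : ∀ m : Fin Nf → ℝ, (∀ f, sInf S < m f) → P m := by
    intro m hm
    have hlt : sInf S < Finset.univ.inf' Finset.univ_nonempty m :=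
      (Finset.lt_inf'_iff _).2 fun f _ => hm f
    obtain ⟨M, hMS, hMt⟩ := exists_lt_of_csInf_lt hne hlt
    exact hMS m fun f => lt_of_lt_of_le hMt (Finset.inf'_le _ (Finset.mem_univ f))
  refine ⟨sInf S, hinf, ?_⟩
  -- (2) the gap closes above the infimum: a uniform rate would push the threshold below the infimum
  by_contra hcl
  push Not at hcl
  obtain ⟨ε, hε, hgap⟩ := hcl
  obtain ⟨δ, hδ, hP⟩ := hO (sInf S) ε hε hinf hgap
  have hmem : sInf S - δ ∈ S := hP
  have hle : sInf S ≤ sInf S - δ := csInf_le hbdd hmem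
  linarith

/-! ## Re-centring the critical mass at a threshold -/

/-- The regularisation with the flavour-blind critical mass shifted by `a_k M / Z_m(k)`.
[cite: MontvayMunster1994, §5.1] -/
def mcritShift (reg : QCDRegularisation Nf) (M : ℝ) : QCDRegularisation Nf :=
  { reg with mcrit := fun k => reg.mcrit k + reg.a k * M / reg.Zm k }

/-- The shift does not touch `HasMassScaling` (which never reads `m_crit`). [folklore] -/
theorem hasMassScaling_mcritShift_iff (reg : QCDRegularisation Nf) (M : ℝ) :
    (mcritShift reg M).HasMassScaling ↔ reg.HasMassScaling :=
  Iff.rfl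

/-- Running the shifted regularisation at masses `m` IS running the original one at `m + M`. [folklore] -/
theorem scheme_mcritShift (reg : QCDRegularisation Nf) (M : ℝ) (m : Fin Nf → ℝ)
    (z shift : QCDField Nf → ℕ → ℝ) :
    (mcritShift reg M).scheme m z shift = reg.scheme (fun f => m f + M) z shift := by
  simp only [QCDRegularisation.scheme, mcritShift, QCDScheme.mk.injEq, true_and, and_true]
  funext f k
  ring

/-- **From an admissible threshold with gap closure to the re-typed conjunct.**  If a mass-scaling regularisation
carries the `QCDOf` body at every tuple above `M` and the lattice gap closes above `M`, re-centring `m_crit` at `M`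
witnesses `QCDOf N_f` (body at all positive tuples AND `IsChiralAtZero`).  No sign condition on `M`. [folklore] -/
theorem qcdOf_of_leastThreshold (reg : QCDRegularisation Nf) (M : ℝ) (hMS : reg.HasMassScaling)
    (hbody : ∀ m : Fin Nf → ℝ, (∀ f, M < m f) →
      ∃ (z shift : QCDField Nf → ℕ → ℝ) (T : OSData (QCDField Nf) 4),
        IsQCDAlong (reg.scheme m z shift) T ∧ T.IsNontrivial QCDField.glue ∧ T.IsNonGaussian QCDField.glue ∧
          (∀ f g : Fin Nf, f ≠ g → T.IsNontrivial (QCDField.pseudoRe f g)) ∧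
            ∃ Δ > 0, T.HasMassGap Δ ∧ (reg.scheme m z shift).HasLatticeMassGap Δ)
    (hcl : ∀ ε > 0, ∃ m : Fin Nf → ℝ, (∀ f, M < m f) ∧ ¬ (reg.scheme m 0 0).HasLatticeMassGap ε) :
    QCDOf Nf := by
  refine ⟨mcritShift reg M, (hasMassScaling_mcritShift_iff reg M).2 hMS, fun ε hε => ?_, fun m hm => ?_⟩
  · obtain ⟨m, hm, hgap⟩ := hcl ε hε
    refine ⟨fun f => m f - M, fun f => by linarith [hm f], ?_⟩
    have hm' : (fun f => (m f - M) + M) = m := funext fun f => by ring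
    rw [scheme_mcritShift, hm']
    exact hgap
  · obtain ⟨z, shift, T, hQ, hN, hG, hP, Δ, hΔ, hT, hL⟩ := hbody (fun f => m f + M) (fun f => by linarith [hm f])
    refine ⟨z, shift, T, ?_, hN, hG, hP, Δ, hΔ, hT, ?_⟩
    · rwa [scheme_mcritShift]
    · rwa [scheme_mcritShift]

/-- **Per-flavour-number assembly** (`N_f ≠ 0`, one mass-scaling regularisation): a threshold for the body, mass
continuation below uniformly gapped thresholds, and a gapless tuple give `QCDOf N_f` — through the least admissible
threshold and the re-centred critical mass. [folklore] -/
theorem qcdOf_of_pieces [NeZero Nf] (reg : QCDRegularisation Nf) (hMS : reg.HasMassScaling)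
    (hT : ∃ M₀ : ℝ, ∀ m : Fin Nf → ℝ, (∀ f, M₀ < m f) →
      ∃ (z shift : QCDField Nf → ℕ → ℝ) (T : OSData (QCDField Nf) 4),
        IsQCDAlong (reg.scheme m z shift) T ∧ T.IsNontrivial QCDField.glue ∧ T.IsNonGaussian QCDField.glue ∧
          (∀ f g : Fin Nf, f ≠ g → T.IsNontrivial (QCDField.pseudoRe f g)) ∧
            ∃ Δ > 0, T.HasMassGap Δ ∧ (reg.scheme m z shift).HasLatticeMassGap Δ)
    (hO : ∀ M ε : ℝ, 0 < ε →
      (∀ m : Fin Nf → ℝ, (∀ f, M < m f) →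
        ∃ (z shift : QCDField Nf → ℕ → ℝ) (T : OSData (QCDField Nf) 4),
          IsQCDAlong (reg.scheme m z shift) T ∧ T.IsNontrivial QCDField.glue ∧ T.IsNonGaussian QCDField.glue ∧
            (∀ f g : Fin Nf, f ≠ g → T.IsNontrivial (QCDField.pseudoRe f g)) ∧
              ∃ Δ > 0, T.HasMassGap Δ ∧ (reg.scheme m z shift).HasLatticeMassGap Δ) →
      (∀ m : Fin Nf → ℝ, (∀ f, M < m f) → (reg.scheme m 0 0).HasLatticeMassGap ε) →
        ∃ δ > 0, ∀ m : Fin Nf → ℝ, (∀ f, M - δ < m f) →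
          ∃ (z shift : QCDField Nf → ℕ → ℝ) (T : OSData (QCDField Nf) 4),
            IsQCDAlong (reg.scheme m z shift) T ∧ T.IsNontrivial QCDField.glue ∧ T.IsNonGaussian QCDField.glue ∧
              (∀ f g : Fin Nf, f ≠ g → T.IsNontrivial (QCDField.pseudoRe f g)) ∧
                ∃ Δ > 0, T.HasMassGap Δ ∧ (reg.scheme m z shift).HasLatticeMassGap Δ)
    (hG : ∃ m₀ : Fin Nf → ℝ, ∀ Δ, 0 < Δ → ¬ (reg.scheme m₀ 0 0).HasLatticeMassGap Δ) :
    QCDOf Nf := by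
  obtain ⟨M, hbody, hcl⟩ := exists_least_threshold
    (fun m : Fin Nf → ℝ =>
      ∃ (z shift : QCDField Nf → ℕ → ℝ) (T : OSData (QCDField Nf) 4),
        IsQCDAlong (reg.scheme m z shift) T ∧ T.IsNontrivial QCDField.glue ∧ T.IsNonGaussian QCDField.glue ∧
          (∀ f g : Fin Nf, f ≠ g → T.IsNontrivial (QCDField.pseudoRe f g)) ∧
            ∃ Δ > 0, T.HasMassGap Δ ∧ (reg.scheme m z shift).HasLatticeMassGap Δ)
    (fun m ε => (reg.scheme m 0 0).HasLatticeMassGap ε)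
    (by
      -- good tuples are gapped: `HasLatticeMassGap` never reads `z, shift` (definitional)
      rintro m ⟨z, shift, T, -, -, -, -, Δ, hΔ, -, hL⟩
      exact ⟨Δ, hΔ, hL⟩)
    hT hO hG
  exact qcdOf_of_leastThreshold reg M hMS hbody hcl

/-! ## The composition (route items by name) -/

/-- **THE ASSEMBLY of the strategist's decomposition of crux stmt-QuantumFields-9737**:
`ThresholdQCD → MassContinuation → ChiralTupleGapless → StableActionBridge` (items 8794, 18327, 18328 by name).  The bridge is
`UnquenchedChessboardBound → WilsonQuarkStability → QCD`; its two hypotheses are theorems of the tree and are not used — the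
content is `qcdOf_of_pieces` (least admissible threshold + re-centred critical mass) at `N_f = 2` and `N_f = 3`. [folklore] -/
theorem StableActionBridge_of : ThresholdQCD → MassContinuation → ChiralTupleGapless → StableActionBridge := by
  intro hT hO hG _ _
  have key : ∀ (N : ℕ) [NeZero N], N = 2 ∨ N = 3 → QCDOf N := by
    intro N _ hN
    obtain ⟨M₀, -, reg, hMS, hbody⟩ := hT N hN
    exact qcdOf_of_pieces reg hMS ⟨M₀, hbody⟩
      (fun M ε hε hb hg => hO N hN reg M ε hMS hε hb hg) (hG N hN reg M₀ hMS hbody)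
  exact ⟨key 2 (Or.inl rfl), key 3 (Or.inr rfl)⟩

/-- **The glue item stmt-QuantumFields-18329 BY NAME** (`StableActionBridgeOfPieces :=
ThresholdQCD → MassContinuation → ChiralTupleGapless → StableActionBridge`). [folklore] -/
theorem stableActionBridgeOfPieces_proof : StableActionBridgeOfPieces :=
  StableActionBridge_of

/-- **The replaced item is derived**: `MassContinuation → ChiralTupleGapless → ChiralCompletion` (item stmt-QuantumFields-17394,
re-badged support). [folklore] -/
theorem chiralCompletion_of_pieces : MassContinuation → ChiralTupleGapless → ChiralCompletion := by
  intro hO hG Nf hNf hthr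
  obtain ⟨M₀, -, reg, hMS, hbody⟩ := hthr
  have key : ∀ (N : ℕ) [NeZero N], N = 2 ∨ N = 3 → ∀ (reg : QCDRegularisation N) (M₀ : ℝ),
      reg.HasMassScaling →
      (∀ m : Fin N → ℝ, (∀ f, M₀ < m f) →
        ∃ (z shift : QCDField N → ℕ → ℝ) (T : OSData (QCDField N) 4),
          IsQCDAlong (reg.scheme m z shift) T ∧ T.IsNontrivial QCDField.glue ∧ T.IsNonGaussian QCDField.glue ∧
            (∀ f g : Fin N, f ≠ g → T.IsNontrivial (QCDField.pseudoRe f g)) ∧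
              ∃ Δ > 0, T.HasMassGap Δ ∧ (reg.scheme m z shift).HasLatticeMassGap Δ) → QCDOf N := by
    intro N _ hN reg M₀ hMS hbody
    exact qcdOf_of_pieces reg hMS ⟨M₀, hbody⟩
      (fun M ε hε hb hg => hO N hN reg M ε hMS hε hb hg) (hG N hN reg M₀ hMS hbody)
  rcases hNf with rfl | rfl
  · exact key 2 (Or.inl rfl) reg M₀ hMS hbody
  · exact key 3 (Or.inr rfl) reg M₀ hMS hbody

/-- `QCD` itself from the three items (the conjunct the bridge names). [folklore] -/
theorem qcd_of_pieces (hT : ThresholdQCD) (hO : MassContinuation) (hG : ChiralTupleGapless) : _root_.QCD := by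
  have key : ∀ (N : ℕ) [NeZero N], N = 2 ∨ N = 3 → QCDOf N := by
    intro N _ hN
    obtain ⟨M₀, -, reg, hMS, hbody⟩ := hT N hN
    exact qcdOf_of_pieces reg hMS ⟨M₀, hbody⟩
      (fun M ε hε hb hg => hO N hN reg M ε hMS hε hb hg) (hG N hN reg M₀ hMS hbody)
  exact ⟨key 2 (Or.inl rfl), key 3 (Or.inr rfl)⟩

/-- The crux from the three registered stubs (sorries only through the stubs). -/
theorem StableActionBridge_closed : StableActionBridge :=
  StableActionBridge_of stub_thresholdQCD stub_massContinuation stub_chiralTupleGapless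

end Summit.QuantumFields.QCD.Cruxes.StableActionBridge.LeastThreshold

end
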